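/-
Copyright (c) 2026 the pub-hodgecm-mathlib formalisation cell (harness21).  Prover seat hodgecm-mathlib-K2E1-p16 (g2), Track B «K2-LIT» ENGINE E1, h413 = `stmt-HodgeConjecture-24833`,
route `HCCMUnconditional`, R90-S8 «ContSpec-n½» #4′ letter chain, H8 (IDENT) FILE 2b (S8 dealer R90-CS-plan (g2), S8-R47 «=», booked name): THE RESIDUE CLASSES LIE IN THE
SELF-DUAL BLOCK — the canonical atom vectors of the block (range splitting by Mellin interpolation), the letter-free edition of K2E2-p12's (M) `hatom`, and the identification of
the genuine residue classes from the pairing and norm letters.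
-/
import Summits.HodgeConjecture.HodgeConjecture.Theorems.R90S8BlockAtomsAreResiduesU2             -- ★ p862561 (this seat) H8 FILE 1: `blockAtoms_subset_span_residues_of_letters`
import Summits.HodgeConjecture.HodgeConjecture.Theorems.R90S8MellinInterpolationVanishingAxis     -- ★ (this seat) H8 FILE 2a: `exists_mellin_interpolant_small_axis`
import Summits.HodgeConjecture.HodgeConjecture.Theorems.K2E1ChiSectionPlancherelSelfDualOfLetters  -- ★ (K2E4-p10) SD package §1: `norm_map_eq_of_inner_map_map`, `continuous_transform`
import HarnessLib

/-!
# h413 ∕ R90-S8 #4′ chain, H8 (IDENT) FILE 2b — `R90S8ResidueClassesInBlockU2`: THE CANONICAL ATOM VECTORS OF A SELF-DUAL BLOCK; RESIDUE CLASSES LIE IN THE BLOCK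

Cell `pub/hodgecm-mathlib`, crux H413 = `stmt-HodgeConjecture-24833`; S8 dealer R90-CS-plan (g2) S8-R47; census `K2/K2E1-p16/g2/CENSUS-H8.md` §2 (route (R2) «Mellin interpolation»).
THEOREMS ONLY (no `def`, no `instance`, no `notation`, no named-fact hypothesis, no `sorry`; default heartbeats); lane `--kind proof --supports stmt-HodgeConjecture-24833 --as helper`
(count-neutral).  ABSTRACT HILBERT-SPACE FILE over the binders of the ★ self-dual Plancherel package (`K2E1ChiSectionPlancherelSelfDualOfLetters.exists_linearIsometry_selfDual_of_letters`):
a complete block `Θ` with dense generators `x i ∈ Θ`, profiles `f i a ∈ C²_c((0,∞))`, vectors `φ a ∈ V`, the isometry `Uiso : Θ →ₗᵢ (⊕_{c∈S} V) ⊕₂ L²((0,∞); V)` with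
`Uiso x_i = (r_i, √(C∕2π)·w_i)` (`hU`), the atom Gram `hrG`, the axis vectors `hw`, the axis isometry `hc1` of `M(½+it)`; plus the INDEX RICHNESS letter `hι` («every admissible
profile tuple occurs among the `f i`» — true for the generator family of `resHBlock`, where the index IS the set of admissible profiles).

THE MATHEMATICS ([MoeglinWaldspurger1995, II.1.10–II.1.11, IV.1.11, V.3.13, VI.2]; [Langlands1976, §7, Lemmas 7.5–7.6]).  RANGE SPLITTING OF THE SELF-DUAL BLOCK: for a pole `c₀ ∈ S`
(`c₀ > ½`) and a slot `a₀`, the ★ FILE 2a profiles `F_ε` (`F̃_ε(−c) = δ_{c,c₀}` on `S`, axis norm `≤ ε`) placed in slot `a₀` give generators `x_{i_ε} ∈ Θ` with a FIXED atom coordinate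
`ρ = r_{i_ε}` (the Gram `hrG` only sees the Mellin values at the poles) and line coordinate of norm `≤ 2‖φ_{a₀}‖·√(C∕2π)·ε` (`hw` + `hc1`), so `(ρ, 0) ∈ closure (range Uiso) = range Uiso`
(complete `Θ`): there is a CANONICAL ATOM VECTOR `g (c₀,a₀) ∈ Θ` with `Uiso g = (ρ, 0)`, pairings `⟪x_i, g⟫ = ⟪r_i, ρ⟫ = C·⟪Ψ̂_i(−c₀), R_{c₀} φ_{a₀}⟫` and
`‖g‖² = C·⟪φ_{a₀}, R_{c₀} φ_{a₀}⟫`.  CONSEQUENCES: (i) by ★ FILE 1 the pure-atom vectors of the block are spanned by the `g (c,a)` — K2E2-p12's (M) letter `hatom` for `e := g` with NO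
residue letter at all (`blockAtoms_subset_span_atomVectors`); (ii) a vector `e` with the PAIRING letter of `g (c₀,a₀)` and the NORM letter `‖e‖² = C·re⟪φ_{a₀}, R_{c₀} φ_{a₀}⟫` IS
`g (c₀,a₀)` (`P_Θ e = g` by density, then Pythagoras) — so the genuine residue classes `[Res_{z=c} E(φ_a, z)]` (pairing = adjunction + (L-CT), norm = Maass–Selberg at the pole,
[MoeglinWaldspurger1995, IV.1.11]) lie IN the block with vanishing line coordinate: (E1)+(E2) of the census from `hpair` + `hnorm`.
* §1 `sum_mellin_single_smul`, `single_profile_admissible` (the profile tuple `(a ↦ if a = a₀ then F else 0)`), `eLpNorm_axisModel_single_le` (the line coordinate bound `≤ 2‖φ_{a₀}‖·ε`).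
* §2 HEAD **`exists_atomVector`** — the canonical atom vector `g (c₀, a₀)`.
* §3 **`blockAtoms_subset_span_atomVectors`** — the family `g : S × α → Θ` and (M) `hatom` letter-free for `e := g` (★ FILE 1 ∘ §2).
* §4 **`eq_of_pairing_eq_of_norm_sq_eq`**, **`mem_block_and_snd_eq_zero_of_pairing_of_norm`** — identification of the residue classes: (E1)+(E2) from `hpair` + `hnorm`.
HONEST LABEL: HC_CM is proved only modulo the 7 printed citations (2 remaining named inputs: hLiu418 = `stmt-HodgeConjecture-24832`, h413 = `stmt-HodgeConjecture-24833`) until rung 0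
closes; this file asserts no named fact, is conditional by construction on the visible binders of the ★ SD package + `hι` (+ `hpair`, `hnorm` in §4), and closes no socket; count-neutral.

## References
* [MoeglinWaldspurger1995] C. Mœglin, J.-L. Waldspurger, *Spectral Decomposition and Eisenstein Series* (1995), II.1.10–II.1.11, IV.1.11, V.3.13, VI.2.
* [Langlands1976] R. P. Langlands, *On the Functional Equations Satisfied by Eisenstein Series*, LNM 544 (1976), §7.
* [ReedSimonI1980] M. Reed, B. Simon, *Methods of Modern Mathematical Physics I* (1980), Thm. II.3, Thm. I.7.
-/

set_option autoImplicit false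
-- the mandated namespace `…HodgeConjecture.HodgeConjecture.R90.S8` (LEAD #1 L1) repeats the summit's segment
set_option linter.dupNamespace false

noncomputable section

open MeasureTheory Measure Set Filter Topology Complex
open scoped Real ENNReal InnerProductSpace ComplexConjugate BigOperators
open Summit.HodgeConjecture.HodgeConjecture.Cruxes.H413.K2E1ChiSectionPlancherelKTypeCMTwo (continuous_mellin_neg_axis)
open Summit.HodgeConjecture.HodgeConjecture.Cruxes.H413.K2E1ChiSectionPlancherelSelfDualOfLetters (norm_map_eq_of_inner_map_map)

namespace Summit.HodgeConjecture.HodgeConjecture.R90.S8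

variable {V : Type*} [NormedAddCommGroup V] [InnerProductSpace ℂ V]

/-! ## §1 The profile tuple concentrated in one slot, and the line-coordinate bound -/

/-- The Mellin transform of the zero profile vanishes. [folklore] -/
theorem mellin_zero_fun (s : ℂ) : mellin (fun _ : ℝ => (0 : ℂ)) s = 0 := by
  simp [mellin]

/-- **THE TRANSFORM OF A ONE-SLOT PROFILE TUPLE**: `Σ_a mellin (if a = a₀ then F else 0) s • φ_a = mellin F s • φ_{a₀}`. [folklore] -/
theorem sum_mellin_single_smul {α : Type*} [Fintype α] [DecidableEq α] (F : ℝ → ℂ) (a₀ : α) (φ : α → V) (s : ℂ) :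
    ∑ a, mellin (if a = a₀ then F else fun _ => (0 : ℂ)) s • φ a = mellin F s • φ a₀ := by
  rw [Finset.sum_eq_single a₀]
  · simp
  · intro a _ ha
    simp only [if_neg ha, mellin_zero_fun, zero_smul]
  · intro h
    exact absurd (Finset.mem_univ a₀) h

/-- The one-slot profile tuple is admissible (`C²`, compact support in `(0,∞)`) when `F` is. [folklore] -/
theorem single_profile_admissible {α : Type*} [DecidableEq α] {F : ℝ → ℂ} (hF : ContDiff ℝ 2 F) (hFs : HasCompactSupport F) (hF0 : tsupport F ⊆ Ioi 0) (a₀ : α) :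
    (∀ a, ContDiff ℝ 2 (if a = a₀ then F else fun _ => (0 : ℂ))) ∧ (∀ a, HasCompactSupport (if a = a₀ then F else fun _ => (0 : ℂ))) ∧
      ∀ a, tsupport (if a = a₀ then F else fun _ => (0 : ℂ)) ⊆ Ioi 0 := by
  refine ⟨fun a => ?_, fun a => ?_, fun a => ?_⟩
  · by_cases ha : a = a₀
    · simp only [ha, if_pos]; exact hF
    · simp only [if_neg ha]; exact contDiff_const
  · by_cases ha : a = a₀
    · simp only [ha, if_pos]; exact hFs
    · simp only [if_neg ha]; exact HasCompactSupport.zero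
  · by_cases ha : a = a₀
    · simp only [ha, if_pos]; exact hF0
    · simp only [if_neg ha]
      intro t ht
      simp [tsupport] at ht

/-- **THE LINE-COORDINATE BOUND**: for the one-slot transform `A(t) = F̃(−(½+it))•φ` and an inner-product preserving axis operator `M(½+it)` (`hc1`), the axis model vector
`t ↦ A(t) + M(½−it)A(−t)` has `L²((0,∞); V)`-norm `≤ 2‖φ‖·‖F̃(−(½+i·))‖_{L²(ℝ)}`. [cite: MoeglinWaldspurger1995, IV.3.12] -/
theorem eLpNorm_axisModel_single_le [FiniteDimensional ℂ V] {F : ℝ → ℂ} (hF : ContDiff ℝ 2 F) (hFs : HasCompactSupport F) (hF0 : tsupport F ⊆ Ioi 0) (φ : V)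
    (M : ℂ → V →ₗ[ℂ] V) (hc1 : ∀ (t : ℝ) (v v' : V), ⟪M ((((1 / 2 : ℝ)) : ℂ) + t * I) v, M ((((1 / 2 : ℝ)) : ℂ) + t * I) v'⟫_ℂ = ⟪v, v'⟫_ℂ)
    (hcont : ∀ v : V, Continuous fun t : ℝ => M ((((1 / 2 : ℝ)) : ℂ) + t * I) v) :
    eLpNorm (fun t : ℝ => mellin F (-((((1 / 2 : ℝ)) : ℂ) + t * I)) • φ + M ((((1 / 2 : ℝ)) : ℂ) + ((-t : ℝ) : ℂ) * I) (mellin F (-((((1 / 2 : ℝ)) : ℂ) + ((-t : ℝ) : ℂ) * I)) • φ))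
        2 ((volume : Measure ℝ).restrict (Ioi 0)) ≤
      2 * (‖φ‖ₑ * eLpNorm (fun y : ℝ => mellin F (-((((1 / 2 : ℝ)) : ℂ) + y * I))) 2 volume) := by
  set s : ℝ → ℂ := fun t => mellin F (-((((1 / 2 : ℝ)) : ℂ) + t * I)) with hs
  have hsc : Continuous s := continuous_mellin_neg_axis hF.continuous hFs hF0
  set A : ℝ → V := fun t => s t • φ with hA
  have hAc : Continuous A := hsc.smul continuous_const
  set B : ℝ → V := fun t => M ((((1 / 2 : ℝ)) : ℂ) + ((-t : ℝ) : ℂ) * I) (A (-t)) with hB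
  have hBc : Continuous B := by
    have : B = fun t => s (-t) • M ((((1 / 2 : ℝ)) : ℂ) + ((-t : ℝ) : ℂ) * I) φ := by
      funext t
      simp only [hB, hA, LinearMap.map_smul]
    rw [this]
    exact (hsc.comp continuous_neg).smul ((hcont φ).comp continuous_neg)
  -- the norm of the one-slot transform: `‖φ‖ · ‖s‖`
  have hnA : eLpNorm A 2 (volume : Measure ℝ) = ‖φ‖ₑ * eLpNorm s 2 volume := by
    rw [← eLpNorm_norm A, ← eLpNorm_norm s]
    have : (fun t => ‖A t‖) = ‖φ‖ • fun t => ‖s t‖ := by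
      funext t
      simp only [hA, norm_smul, Pi.smul_apply, smul_eq_mul, mul_comm]
    rw [this, eLpNorm_const_smul, enorm_norm]
  -- `B` has the same pointwise norm as `A ∘ neg`
  have hnB : eLpNorm B 2 ((volume : Measure ℝ).restrict (Ioi 0)) ≤ ‖φ‖ₑ * eLpNorm s 2 volume := by
    have h1 : eLpNorm B 2 ((volume : Measure ℝ).restrict (Ioi 0)) = eLpNorm (A ∘ Neg.neg) 2 ((volume : Measure ℝ).restrict (Ioi 0)) := by
      rw [← eLpNorm_norm B, ← eLpNorm_norm (A ∘ Neg.neg)]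
      congr 1
      funext t
      simp only [hB, Function.comp_apply]
      exact norm_map_eq_of_inner_map_map (hc1 (-t)) _
    rw [h1]
    calc eLpNorm (A ∘ Neg.neg) 2 ((volume : Measure ℝ).restrict (Ioi 0)) ≤ eLpNorm (A ∘ Neg.neg) 2 (volume : Measure ℝ) := eLpNorm_mono_measure _ Measure.restrict_le_self
      _ = eLpNorm A 2 (volume : Measure ℝ) := eLpNorm_comp_measurePreserving hAc.aestronglyMeasurable (Measure.measurePreserving_neg (volume : Measure ℝ))
      _ = ‖φ‖ₑ * eLpNorm s 2 volume := hnA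
  have hnA' : eLpNorm A 2 ((volume : Measure ℝ).restrict (Ioi 0)) ≤ ‖φ‖ₑ * eLpNorm s 2 volume :=
    (eLpNorm_mono_measure _ Measure.restrict_le_self).trans hnA.le
  calc eLpNorm (fun t : ℝ => A t + B t) 2 ((volume : Measure ℝ).restrict (Ioi 0))
      ≤ eLpNorm A 2 ((volume : Measure ℝ).restrict (Ioi 0)) + eLpNorm B 2 ((volume : Measure ℝ).restrict (Ioi 0)) :=
        eLpNorm_add_le hAc.aestronglyMeasurable hBc.aestronglyMeasurable one_le_two
    _ ≤ ‖φ‖ₑ * eLpNorm s 2 volume + ‖φ‖ₑ * eLpNorm s 2 volume := add_le_add hnA' hnB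
    _ = 2 * (‖φ‖ₑ * eLpNorm s 2 volume) := by rw [two_mul]

/-! ## §2 HEAD: the canonical atom vectors of the self-dual block -/

section Atom

variable [FiniteDimensional ℂ V] {H : Type*} [NormedAddCommGroup H] [InnerProductSpace ℂ H] {ι α : Type*} [Fintype α] [DecidableEq α]

/-- **THE CANONICAL ATOM VECTOR OF A SELF-DUAL BLOCK AT A POLE `c₀` AND A SLOT `a₀`** (range splitting).  Binders = the ★ SD Plancherel package on a complete block `Θ` (`x`, `hxΘ`, `f`,
`φ`, `M`, `hc1`, `hcont`, `S`, `hS : ∀ c ∈ S, ½ < c`, `R`, `C`, `r`, `w`, `Uiso`, `hrG`, `hw`, `hU`) + the INDEX RICHNESS letter `hι`.  CONCLUSION: there is `g ∈ Θ` with vanishing line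
coordinate `(Uiso g).2 = 0`, pairings `⟪x_i, g⟫ = C·⟪Ψ̂_i(−c₀), R_{c₀} φ_{a₀}⟫` against every generator, and `‖g‖² = C·re⟪φ_{a₀}, R_{c₀} φ_{a₀}⟫`.  Proof: Mellin interpolation (★ FILE 2a)
in slot `a₀` gives generators with a FIXED atom coordinate `ρ` (the Gram `hrG` only sees Mellin values at the poles) and line coordinate of norm `≤ 2‖φ_{a₀}‖√(C∕2π)·ε` (`hw`, `hc1`),
so `(ρ, 0) ∈ closure (range Uiso) = range Uiso`. [cite: MoeglinWaldspurger1995, II.1.10–II.1.11, IV.1.11, V.3.13] [cite: Langlands1976, §7] -/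
theorem exists_atomVector (f : ι → α → ℝ → ℂ)
    (hι : ∀ G : α → ℝ → ℂ, (∀ a, ContDiff ℝ 2 (G a)) → (∀ a, HasCompactSupport (G a)) → (∀ a, tsupport (G a) ⊆ Ioi 0) → ∃ i, f i = G)
    (φ : α → V) (M : ℂ → V →ₗ[ℂ] V)
    (hc1 : ∀ (t : ℝ) (v v' : V), ⟪M ((((1 / 2 : ℝ)) : ℂ) + t * I) v, M ((((1 / 2 : ℝ)) : ℂ) + t * I) v'⟫_ℂ = ⟪v, v'⟫_ℂ)
    (hcont : ∀ v : V, Continuous fun t : ℝ => M ((((1 / 2 : ℝ)) : ℂ) + t * I) v)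
    (S : Finset ℝ) (hS : ∀ c ∈ S, 1 / 2 < c) (R : ℝ → V →ₗ[ℂ] V)
    (Θ : Submodule ℂ H) [CompleteSpace ↥Θ] (x : ι → H) (hxΘ : ∀ i, x i ∈ Θ)
    (C : ℝ) (r : ι → PiLp 2 (fun _ : ↥S => V)) (w : ι → Lp V 2 ((volume : Measure ℝ).restrict (Ioi 0)))
    (Uiso : ↥Θ →ₗᵢ[ℂ] WithLp 2 (PiLp 2 (fun _ : ↥S => V) × Lp V 2 ((volume : Measure ℝ).restrict (Ioi 0))))
    (hrG : ∀ i j, ⟪r i, r j⟫_ℂ = (C : ℂ) * ∑ c ∈ S, ⟪∑ b, mellin (f i b) (-(c : ℂ)) • φ b, R c (∑ a, mellin (f j a) (-(c : ℂ)) • φ a)⟫_ℂ)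
    (hw : ∀ i, (w i : ℝ → V) =ᵐ[(volume : Measure ℝ).restrict (Ioi 0)] fun t => (∑ a, mellin (f i a) (-((((1 / 2 : ℝ)) : ℂ) + t * I)) • φ a) +
        M ((((1 / 2 : ℝ)) : ℂ) + ((-t : ℝ) : ℂ) * I) (∑ a, mellin (f i a) (-((((1 / 2 : ℝ)) : ℂ) + ((-t : ℝ) : ℂ) * I)) • φ a))
    (hU : ∀ i, Uiso ⟨x i, hxΘ i⟩ = WithLp.toLp 2 (r i, ((Real.sqrt (C * (2 * π)⁻¹) : ℝ) : ℂ) • w i))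
    (c₀ : ↥S) (a₀ : α) :
    ∃ g : ↥Θ, (Uiso g).snd = 0 ∧ (∀ i, ⟪x i, (g : H)⟫_ℂ = (C : ℂ) * ⟪∑ b, mellin (f i b) (-((c₀ : ℝ) : ℂ)) • φ b, R c₀ (φ a₀)⟫_ℂ) ∧
      ‖(g : H)‖ ^ 2 = C * RCLike.re ⟪φ a₀, R c₀ (φ a₀)⟫_ℂ := by
  -- STEP 1: for every `ε > 0` an index whose profile tuple interpolates `δ_{c,c₀} • φ_{a₀}` at the poles with line coordinate `≤ 2‖φ_{a₀}‖·ε`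
  have key : ∀ ε : ℝ, 0 < ε → ∃ i, (∀ c ∈ S, ∑ b, mellin (f i b) (-(c : ℂ)) • φ b = (if c = (c₀ : ℝ) then (1 : ℂ) else 0) • φ a₀) ∧ ‖w i‖ ≤ 2 * ‖φ a₀‖ * ε := by
    intro ε hε
    obtain ⟨F, hF2, hFs, hF0, hval, haxis⟩ := exists_mellin_interpolant_small_axis S hS c₀ c₀.2 hε
    obtain ⟨hG1, hG2, hG3⟩ := single_profile_admissible hF2 hFs hF0 a₀
    obtain ⟨i, hfi⟩ := hι (fun a => if a = a₀ then F else fun _ => (0 : ℂ)) hG1 hG2 hG3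
    have hfa : ∀ a, f i a = if a = a₀ then F else fun _ => (0 : ℂ) := fun a => by rw [hfi]
    refine ⟨i, fun c hc => ?_, ?_⟩
    · simp_rw [hfa]
      rw [sum_mellin_single_smul, hval c hc]
    · -- the `L²` norm of the axis model vector
      have hax : (w i : ℝ → V) =ᵐ[(volume : Measure ℝ).restrict (Ioi 0)] fun t => mellin F (-((((1 / 2 : ℝ)) : ℂ) + t * I)) • φ a₀ +
          M ((((1 / 2 : ℝ)) : ℂ) + ((-t : ℝ) : ℂ) * I) (mellin F (-((((1 / 2 : ℝ)) : ℂ) + ((-t : ℝ) : ℂ) * I)) • φ a₀) := by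
        refine (hw i).trans (Eventually.of_forall fun t => ?_)
        simp_rw [hfa]
        rw [sum_mellin_single_smul]
        have h2 : ∑ a, mellin (if a = a₀ then F else fun _ => (0 : ℂ)) (-((((1 / 2 : ℝ)) : ℂ) + ((-t : ℝ) : ℂ) * I)) • φ a =
            mellin F (-((((1 / 2 : ℝ)) : ℂ) + ((-t : ℝ) : ℂ) * I)) • φ a₀ := sum_mellin_single_smul F a₀ φ _
        rw [h2]
      have hb := eLpNorm_axisModel_single_le hF2 hFs hF0 (φ a₀) M hc1 hcont
      rw [Lp.norm_def, eLpNorm_congr_ae hax]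
      refine ENNReal.toReal_le_of_le_ofReal (by positivity) (hb.trans ?_)
      calc 2 * (‖φ a₀‖ₑ * eLpNorm (fun y : ℝ => mellin F (-((((1 / 2 : ℝ)) : ℂ) + y * I))) 2 volume)
          ≤ 2 * (‖φ a₀‖ₑ * ENNReal.ofReal ε) := by gcongr
        _ = ENNReal.ofReal (2 * ‖φ a₀‖ * ε) := by
            rw [← ofReal_norm, ← ENNReal.ofReal_mul (norm_nonneg _), show (2 : ℝ≥0∞) = ENNReal.ofReal 2 by norm_num,
              ← ENNReal.ofReal_mul (by norm_num : (0 : ℝ) ≤ 2), mul_assoc]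
  -- STEP 2: all interpolating indices have the SAME atom coordinate `ρ` (the Gram only sees the Mellin values at the poles)
  obtain ⟨i₁, hΨ₁, -⟩ := key 1 one_pos
  have hGram : ∀ i j, (∀ c ∈ S, ∑ b, mellin (f i b) (-(c : ℂ)) • φ b = (if c = (c₀ : ℝ) then (1 : ℂ) else 0) • φ a₀) →
      (∀ c ∈ S, ∑ b, mellin (f j b) (-(c : ℂ)) • φ b = (if c = (c₀ : ℝ) then (1 : ℂ) else 0) • φ a₀) → ⟪r i, r j⟫_ℂ = (C : ℂ) * ⟪φ a₀, R c₀ (φ a₀)⟫_ℂ := by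
    intro i j hi hj
    rw [hrG i j, Finset.sum_congr rfl (fun c hc => by rw [hi c hc, hj c hc]), Finset.sum_eq_single (c₀ : ℝ)]
    · simp
    · intro c _ hc
      simp [if_neg hc]
    · intro h
      exact absurd c₀.2 h
  -- the pairing of ANY generator with an interpolating one
  have hpair' : ∀ i j, (∀ c ∈ S, ∑ b, mellin (f j b) (-(c : ℂ)) • φ b = (if c = (c₀ : ℝ) then (1 : ℂ) else 0) • φ a₀) →
      ⟪r i, r j⟫_ℂ = (C : ℂ) * ⟪∑ b, mellin (f i b) (-((c₀ : ℝ) : ℂ)) • φ b, R c₀ (φ a₀)⟫_ℂ := by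
    intro i j hj
    rw [hrG i j, Finset.sum_congr rfl (fun c hc => by rw [hj c hc]), Finset.sum_eq_single (c₀ : ℝ)]
    · simp
    · intro c _ hc
      simp [if_neg hc]
    · intro h
      exact absurd c₀.2 h
  set ρ : PiLp 2 (fun _ : ↥S => V) := r i₁ with hρ
  have hr : ∀ i, (∀ c ∈ S, ∑ b, mellin (f i b) (-(c : ℂ)) • φ b = (if c = (c₀ : ℝ) then (1 : ℂ) else 0) • φ a₀) → r i = ρ := by
    intro i hi
    rw [← sub_eq_zero, ← @inner_self_eq_zero ℂ, inner_sub_left, inner_sub_right, inner_sub_right, hGram i i hi hi, hGram i i₁ hi hΨ₁, hGram i₁ i hΨ₁ hi,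
      hGram i₁ i₁ hΨ₁ hΨ₁]
    ring
  -- STEP 3: `(ρ, 0)` lies in the closure of `range Uiso`, which is closed (`Θ` complete, `Uiso` isometric)
  set y : WithLp 2 (PiLp 2 (fun _ : ↥S => V) × Lp V 2 ((volume : Measure ℝ).restrict (Ioi 0))) := WithLp.toLp 2 (ρ, 0) with hy
  have hycl : y ∈ closure (Set.range Uiso) := by
    rw [Metric.mem_closure_iff]
    intro ε hε
    set K : ℝ := ‖((Real.sqrt (C * (2 * π)⁻¹) : ℝ) : ℂ)‖ * (2 * ‖φ a₀‖) with hK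
    have hK0 : 0 ≤ K := by positivity
    obtain ⟨i, hΨi, hwi⟩ := key (ε / (K + 1)) (div_pos hε (by linarith))
    refine ⟨Uiso ⟨x i, hxΘ i⟩, ⟨_, rfl⟩, ?_⟩
    rw [dist_eq_norm, hU i, hr i hΨi, hy, ← WithLp.toLp_sub, Prod.mk_sub_mk, sub_self, zero_sub, WithLp.norm_toLp_snd, norm_neg, norm_smul]
    calc ‖((Real.sqrt (C * (2 * π)⁻¹) : ℝ) : ℂ)‖ * ‖w i‖ ≤ ‖((Real.sqrt (C * (2 * π)⁻¹) : ℝ) : ℂ)‖ * (2 * ‖φ a₀‖ * (ε / (K + 1))) :=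
          mul_le_mul_of_nonneg_left hwi (norm_nonneg _)
      _ = ε * (K / (K + 1)) := by rw [hK]; ring
      _ < ε * 1 := mul_lt_mul_of_pos_left ((div_lt_one (by linarith)).2 (by linarith)) hε
      _ = ε := mul_one ε
  have hclosed : IsClosed (Set.range Uiso) := (Uiso.isometry.isClosedEmbedding).isClosed_range
  rw [hclosed.closure_eq] at hycl
  obtain ⟨g, hg⟩ := hycl
  refine ⟨g, ?_, ?_, ?_⟩
  · rw [hg, hy, WithLp.toLp_snd]
  · intro i
    have hci : ⟪x i, (g : H)⟫_ℂ = ⟪(⟨x i, hxΘ i⟩ : ↥Θ), g⟫_ℂ := (Submodule.coe_inner Θ (⟨x i, hxΘ i⟩ : ↥Θ) g).symm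
    rw [hci, ← Uiso.inner_map_map, hU i, hg, hy, WithLp.prod_inner_apply]
    simp only [inner_zero_right, add_zero]
    exact hpair' i i₁ hΨ₁
  · rw [Submodule.norm_coe, ← Uiso.norm_map, hg, hy, WithLp.norm_toLp_fst, @norm_sq_eq_re_inner ℂ, hρ, hGram i₁ i₁ hΨ₁ hΨ₁, RCLike.re_to_complex,
      Complex.re_ofReal_mul]
    rfl

/-! ## §3 (M) `hatom` LETTER-FREE for the canonical atom vectors -/

/-- **THE PURE-ATOM VECTORS OF A SELF-DUAL BLOCK ARE SPANNED BY ITS CANONICAL ATOM VECTORS — K2E2-p12's (M) letter `hatom` WITH NO RESIDUE LETTER.**  Binders = the ★ SD package on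
a complete block `Θ` with dense generators (`hxΘ`, `hΘ`) + `hRsymm` + the index richness `hι`.  There is a FINITE family `g : S × α → H` of block vectors with vanishing line
coordinate, pairings `⟪x_i, g (c,a)⟫ = C·⟪Ψ̂_i(−c), R_c φ_a⟫`, norms `‖g (c,a)‖² = C·re⟪φ_a, R_c φ_a⟫` (★ §2), AND `∀ v ∈ Θ, (U v).2 = 0 → v ∈ span (range g)` at the ★ D5′
model map `U = WithLp.linearEquiv ∘ₗ (Uiso ∘L P_Θ)` (★ FILE 1 `blockAtoms_subset_span_residues_of_letters` with (E1), (E2), `hpair` DISCHARGED by §2).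
[cite: MoeglinWaldspurger1995, IV.1.11, V.3.13, VI.2] [cite: Langlands1976, §7] -/
theorem blockAtoms_subset_span_atomVectors (f : ι → α → ℝ → ℂ)
    (hι : ∀ G : α → ℝ → ℂ, (∀ a, ContDiff ℝ 2 (G a)) → (∀ a, HasCompactSupport (G a)) → (∀ a, tsupport (G a) ⊆ Ioi 0) → ∃ i, f i = G)
    (φ : α → V) (M : ℂ → V →ₗ[ℂ] V)
    (hc1 : ∀ (t : ℝ) (v v' : V), ⟪M ((((1 / 2 : ℝ)) : ℂ) + t * I) v, M ((((1 / 2 : ℝ)) : ℂ) + t * I) v'⟫_ℂ = ⟪v, v'⟫_ℂ)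
    (hcont : ∀ v : V, Continuous fun t : ℝ => M ((((1 / 2 : ℝ)) : ℂ) + t * I) v)
    (S : Finset ℝ) (hS : ∀ c ∈ S, 1 / 2 < c) (R : ℝ → V →ₗ[ℂ] V) (hRsymm : ∀ c ∈ S, ∀ v v' : V, ⟪v, R c v'⟫_ℂ = ⟪R c v, v'⟫_ℂ)
    (Θ : Submodule ℂ H) [CompleteSpace ↥Θ] (x : ι → H) (hxΘ : ∀ i, x i ∈ Θ) (hΘ : (Θ : Set H) ⊆ closure (Submodule.span ℂ (Set.range x) : Set H))
    (C : ℝ) (r : ι → PiLp 2 (fun _ : ↥S => V)) (w : ι → Lp V 2 ((volume : Measure ℝ).restrict (Ioi 0)))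
    (Uiso : ↥Θ →ₗᵢ[ℂ] WithLp 2 (PiLp 2 (fun _ : ↥S => V) × Lp V 2 ((volume : Measure ℝ).restrict (Ioi 0))))
    (hrG : ∀ i j, ⟪r i, r j⟫_ℂ = (C : ℂ) * ∑ c ∈ S, ⟪∑ b, mellin (f i b) (-(c : ℂ)) • φ b, R c (∑ a, mellin (f j a) (-(c : ℂ)) • φ a)⟫_ℂ)
    (hw : ∀ i, (w i : ℝ → V) =ᵐ[(volume : Measure ℝ).restrict (Ioi 0)] fun t => (∑ a, mellin (f i a) (-((((1 / 2 : ℝ)) : ℂ) + t * I)) • φ a) +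
        M ((((1 / 2 : ℝ)) : ℂ) + ((-t : ℝ) : ℂ) * I) (∑ a, mellin (f i a) (-((((1 / 2 : ℝ)) : ℂ) + ((-t : ℝ) : ℂ) * I)) • φ a))
    (hU : ∀ i, Uiso ⟨x i, hxΘ i⟩ = WithLp.toLp 2 (r i, ((Real.sqrt (C * (2 * π)⁻¹) : ℝ) : ℂ) • w i)) :
    ∃ g : ↥S × α → H, (∀ p, g p ∈ Θ) ∧
      (∀ p, (((WithLp.linearEquiv 2 ℂ (PiLp 2 (fun _ : ↥S => V) × Lp V 2 ((volume : Measure ℝ).restrict (Ioi 0)))).toLinearMap ∘ₗ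
        (Uiso.toContinuousLinearMap.comp Θ.orthogonalProjectionOnto).toLinearMap) (g p)).2 = 0) ∧
      (∀ (i : ι) (c : ↥S) (a : α), ⟪x i, g (c, a)⟫_ℂ = (C : ℂ) * ⟪∑ b, mellin (f i b) (-((c : ℝ) : ℂ)) • φ b, R c (φ a)⟫_ℂ) ∧
      (∀ (c : ↥S) (a : α), ‖g (c, a)‖ ^ 2 = C * RCLike.re ⟪φ a, R c (φ a)⟫_ℂ) ∧
      ∀ v ∈ Θ, (((WithLp.linearEquiv 2 ℂ (PiLp 2 (fun _ : ↥S => V) × Lp V 2 ((volume : Measure ℝ).restrict (Ioi 0)))).toLinearMap ∘ₗ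
          (Uiso.toContinuousLinearMap.comp Θ.orthogonalProjectionOnto).toLinearMap) v).2 = 0 → v ∈ Submodule.span ℂ (Set.range g) := by
  -- the canonical atom vectors (★ §2), one per (pole, slot)
  have hex := fun p : ↥S × α => exists_atomVector f hι φ M hc1 hcont S hS R Θ x hxΘ C r w Uiso hrG hw hU p.1 p.2
  choose g hg2 hgpair hgnorm using hex
  have hU0 : ∀ p, (((WithLp.linearEquiv 2 ℂ (PiLp 2 (fun _ : ↥S => V) × Lp V 2 ((volume : Measure ℝ).restrict (Ioi 0)))).toLinearMap ∘ₗ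
      (Uiso.toContinuousLinearMap.comp Θ.orthogonalProjectionOnto).toLinearMap) (g p : H)).2 = 0 := fun p => by
    rw [LinearMap.comp_apply, LinearEquiv.coe_toLinearMap, WithLp.coe_linearEquiv, ContinuousLinearMap.coe_coe, ContinuousLinearMap.comp_apply,
      Submodule.orthogonalProjectionOnto_mem_subspace_eq_self]
    exact hg2 p
  refine ⟨fun p => (g p : H), fun p => (g p).2, hU0, fun i c a => hgpair (c, a) i, fun c a => hgnorm (c, a), ?_⟩
  exact blockAtoms_subset_span_residues_of_letters f φ S R hRsymm Θ x hxΘ hΘ C r (fun i => ((Real.sqrt (C * (2 * π)⁻¹) : ℝ) : ℂ) • w i) Uiso hU hrG Θ le_rfl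
    (fun p => (g p : H)) (fun p => (g p).2) hU0 (fun i c a => hgpair (c, a) i)

/-! ## §4 Identification of the genuine residue classes: (E1)+(E2) from the pairing and norm letters -/

omit [FiniteDimensional ℂ V] [Fintype α] [DecidableEq α] in
/-- **A VECTOR WITH THE PAIRINGS AND THE NORM OF A BLOCK VECTOR IS THAT BLOCK VECTOR**: `g ∈ Θ` (complete, generators `x_i ∈ Θ` dense), `⟪x_i, e⟫ = ⟪x_i, g⟫` for all `i`, and
`‖e‖² = ‖g‖²` ⇒ `e = g`.  Proof: `P_Θ e − g ∈ Θ` is orthogonal to every generator, hence to `Θ`, so `P_Θ e = g`; Pythagoras `‖e‖² = ‖P_Θ e‖² + ‖e − P_Θ e‖²` forces `e = P_Θ e`.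
[cite: ReedSimonI1980, Thm. II.3] -/
theorem eq_of_pairing_eq_of_norm_sq_eq (Θ : Submodule ℂ H) [CompleteSpace ↥Θ] (x : ι → H) (hxΘ : ∀ i, x i ∈ Θ)
    (hΘ : (Θ : Set H) ⊆ closure (Submodule.span ℂ (Set.range x) : Set H)) {g e : H} (hg : g ∈ Θ)
    (hpe : ∀ i, ⟪x i, e⟫_ℂ = ⟪x i, g⟫_ℂ) (hn : ‖e‖ ^ 2 = ‖g‖ ^ 2) : e = g := by
  -- `u := P_Θ e − g ∈ Θ` is orthogonal to the generators
  set u : H := Θ.starProjection e - g with hu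
  have huΘ : u ∈ Θ := Θ.sub_mem (Θ.starProjection_apply_mem e) hg
  have hux : ∀ i, ⟪u, x i⟫_ℂ = 0 := fun i => by
    rw [hu, inner_sub_left, Submodule.inner_starProjection_left_eq_right, Submodule.starProjection_eq_self_iff.2 (hxΘ i), ← inner_conj_symm, hpe i, inner_conj_symm, sub_self]
  -- hence to the closed span of the generators, which contains `u`
  have hcl : Set.EqOn (innerSL ℂ u) (0 : H →L[ℂ] ℂ) (closure (Submodule.span ℂ (Set.range x) : Set H)) :=
    ContinuousLinearMap.eqOn_closure_span (by rintro _ ⟨i, rfl⟩; rw [innerSL_apply_apply, hux i]; rfl)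
  have hu0 : u = 0 := by
    have h := hcl (hΘ huΘ)
    have h' : ⟪u, u⟫_ℂ = 0 := by simpa using h
    exact inner_self_eq_zero.1 h'
  have hPe : Θ.starProjection e = g := sub_eq_zero.1 (hu ▸ hu0)
  -- Pythagoras
  have horth : ⟪Θ.starProjection e, e - Θ.starProjection e⟫_ℂ = 0 :=
    Submodule.inner_right_of_mem_orthogonal (Θ.starProjection_apply_mem e) (Θ.sub_starProjection_mem_orthogonal e)
  have hpy : ‖e‖ * ‖e‖ = ‖Θ.starProjection e‖ * ‖Θ.starProjection e‖ + ‖e - Θ.starProjection e‖ * ‖e - Θ.starProjection e‖ := by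
    have h := norm_add_sq_eq_norm_sq_add_norm_sq_of_inner_eq_zero _ _ horth
    rwa [add_sub_cancel] at h
  rw [hPe] at hpy
  have h0 : ‖e - g‖ * ‖e - g‖ = 0 := by nlinarith [hn, hpy, sq_nonneg ‖e‖, sq_nonneg ‖g‖]
  rw [mul_self_eq_zero, norm_eq_zero, sub_eq_zero] at h0
  exact h0

/-- **THE RESIDUE CLASSES LIE IN THE BLOCK, WITH VANISHING LINE COORDINATE — (E1)+(E2) of the census from the PAIRING and NORM letters.**  If `e ∈ H` pairs with every generator as
`⟪x_i, e⟫ = C·⟪Ψ̂_i(−c₀), R_{c₀} φ_{a₀}⟫` (`hpair`: «⟨θ_Ψ, Res_{c₀} E(φ_{a₀})⟩», adjunction + constant term, [MoeglinWaldspurger1995, IV.1.11]) and has `‖e‖² = C·re⟪φ_{a₀}, R_{c₀} φ_{a₀}⟫`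
(`hnorm`: the Maass–Selberg norm of the residue), then `e` IS the canonical atom vector: `e ∈ Θ` and `(Uiso e).2 = 0`.  So the genuine residue classes satisfy the letters (E1) `he` and
(E2) `hU0` of ★ FILE 1. [cite: MoeglinWaldspurger1995, IV.1.11, V.3.13, VI.2] [cite: Langlands1976, §7] -/
theorem mem_block_and_snd_eq_zero_of_pairing_of_norm (f : ι → α → ℝ → ℂ)
    (hι : ∀ G : α → ℝ → ℂ, (∀ a, ContDiff ℝ 2 (G a)) → (∀ a, HasCompactSupport (G a)) → (∀ a, tsupport (G a) ⊆ Ioi 0) → ∃ i, f i = G)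
    (φ : α → V) (M : ℂ → V →ₗ[ℂ] V)
    (hc1 : ∀ (t : ℝ) (v v' : V), ⟪M ((((1 / 2 : ℝ)) : ℂ) + t * I) v, M ((((1 / 2 : ℝ)) : ℂ) + t * I) v'⟫_ℂ = ⟪v, v'⟫_ℂ)
    (hcont : ∀ v : V, Continuous fun t : ℝ => M ((((1 / 2 : ℝ)) : ℂ) + t * I) v)
    (S : Finset ℝ) (hS : ∀ c ∈ S, 1 / 2 < c) (R : ℝ → V →ₗ[ℂ] V)
    (Θ : Submodule ℂ H) [CompleteSpace ↥Θ] (x : ι → H) (hxΘ : ∀ i, x i ∈ Θ) (hΘ : (Θ : Set H) ⊆ closure (Submodule.span ℂ (Set.range x) : Set H))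
    (C : ℝ) (r : ι → PiLp 2 (fun _ : ↥S => V)) (w : ι → Lp V 2 ((volume : Measure ℝ).restrict (Ioi 0)))
    (Uiso : ↥Θ →ₗᵢ[ℂ] WithLp 2 (PiLp 2 (fun _ : ↥S => V) × Lp V 2 ((volume : Measure ℝ).restrict (Ioi 0))))
    (hrG : ∀ i j, ⟪r i, r j⟫_ℂ = (C : ℂ) * ∑ c ∈ S, ⟪∑ b, mellin (f i b) (-(c : ℂ)) • φ b, R c (∑ a, mellin (f j a) (-(c : ℂ)) • φ a)⟫_ℂ)
    (hw : ∀ i, (w i : ℝ → V) =ᵐ[(volume : Measure ℝ).restrict (Ioi 0)] fun t => (∑ a, mellin (f i a) (-((((1 / 2 : ℝ)) : ℂ) + t * I)) • φ a) +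
        M ((((1 / 2 : ℝ)) : ℂ) + ((-t : ℝ) : ℂ) * I) (∑ a, mellin (f i a) (-((((1 / 2 : ℝ)) : ℂ) + ((-t : ℝ) : ℂ) * I)) • φ a))
    (hU : ∀ i, Uiso ⟨x i, hxΘ i⟩ = WithLp.toLp 2 (r i, ((Real.sqrt (C * (2 * π)⁻¹) : ℝ) : ℂ) • w i))
    (c₀ : ↥S) (a₀ : α) (e : H)
    (hpair : ∀ i, ⟪x i, e⟫_ℂ = (C : ℂ) * ⟪∑ b, mellin (f i b) (-((c₀ : ℝ) : ℂ)) • φ b, R c₀ (φ a₀)⟫_ℂ)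
    (hnorm : ‖e‖ ^ 2 = C * RCLike.re ⟪φ a₀, R c₀ (φ a₀)⟫_ℂ) :
    ∃ he : e ∈ Θ, (Uiso ⟨e, he⟩).snd = 0 := by
  obtain ⟨g, hg2, hgpair, hgnorm⟩ := exists_atomVector f hι φ M hc1 hcont S hS R Θ x hxΘ C r w Uiso hrG hw hU c₀ a₀
  have heg : e = (g : H) := eq_of_pairing_eq_of_norm_sq_eq Θ x hxΘ hΘ g.2 (fun i => by rw [hpair i, hgpair i]) (by rw [hnorm, hgnorm])
  subst heg
  exact ⟨g.2, hg2⟩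

end Atom

end Summit.HodgeConjecture.HodgeConjecture.R90.S8

end
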